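import Mathlib
import Summits.NavierStokesRegularity.NavierStokesRegularity.Theses.WakeRatchet
import HarnessLib

/-!
# `WakeRatchet.TailRateRatchetOfDissipationSplit` — inviscid/viscous split of the rate tail
  ratchet (item stmt-NavierStokesRegularity-25648; glue of the gen-1 split of `TailRateRatchet`)

**Statement (verbatim route decl).** `EternalInviscidRate → EternalViscousRate → TailRateRatchet`.

PROOF (the planner's kernel-checked sketch `tailRateRatchet_of_split`). Fix `R ≥ 1`; child (A)
gives a rate `a₀ > 1` and threshold `ε₀ˢ`, child (B) gives `a₁ > 1` and `ε₁ˢ`; take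
`a := min a₀ a₁ > 1` and `εs := min ε₀ˢ ε₁ˢ`. For an admissible eternal solution `W` with covariant
viscosity `ν̂` (`IsEternalVisc ε₀ ν̂ α W`, so `ν̂ ≥ 0`) split on `ν̂ = 0` — then `W` is an INVISCID
eternal solution (`isEternalVisc_zero_iff`) and child (A) applies — versus `ν̂ > 0`, where child
(B) applies; in both cases `(1+ε₀)^{−aᵢ} M ≤ (1+ε₀)^{−a} M` because `a ≤ aᵢ` and `M ≥ 0` (the tail
energies are non-negative).

HONEST FRAMING: glue between statements about Tao-type MODEL lattice ODEs (route WakeRatchet, rung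
TL-M2Break); both children are OPEN cruxes and stay hypotheses; nothing here bears on
Navier–Stokes regularity and no summit is proved.
-/

noncomputable section

set_option linter.dupNamespace false

namespace Summit.NavierStokesRegularity.NavierStokesRegularity.Theorems

open Literature.Analysis.FluidPDE.TaoCascade

/-- **Item stmt-NavierStokesRegularity-25648** (`WakeRatchet.TailRateRatchetOfDissipationSplit`):
the inviscid rate ratchet and the viscous rate ratchet together give the rate tail ratchet, with
rate `min a₀ a₁` and threshold `min ε₀ˢ ε₁ˢ` (case split on the covariant viscosity `ν̂ = 0` /
`ν̂ > 0`). MODEL lattice statement; no Navier–Stokes statement is proved. [this file] -/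
theorem wakeRatchet_tailRateRatchetOfDissipationSplit_proof :
    Summit.NavierStokesRegularity.NavierStokesRegularity.Theses.WakeRatchet.TailRateRatchetOfDissipationSplit := by
  unfold Summit.NavierStokesRegularity.NavierStokesRegularity.Theses.WakeRatchet.TailRateRatchetOfDissipationSplit
    Summit.NavierStokesRegularity.NavierStokesRegularity.Theses.WakeRatchet.EternalInviscidRate
    Summit.NavierStokesRegularity.NavierStokesRegularity.Theses.WakeRatchet.EternalViscousRate
    Summit.NavierStokesRegularity.NavierStokesRegularity.Theses.WakeRatchet.TailRateRatchet
  intro hA hB R hR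
  obtain ⟨a₀, ha₀, εA, hεA, HA⟩ := hA R hR
  obtain ⟨a₁, ha₁, εB, hεB, HB⟩ := hB R hR
  refine ⟨min a₀ a₁, lt_min ha₀ ha₁, min εA εB, lt_min hεA hεB, ?_⟩
  intro ε₀ hε₀ hle α hα νh W hW hU n M hM σ
  -- the tail energies are non-negative, so `M ≥ 0`
  have hM0 : 0 ≤ M :=
    le_trans (tsum_nonneg fun k : ℕ => physEnergy_nonneg ε₀ W (n + (k : ℤ)) σ) (hM σ)
  have h1 : (1 : ℝ) ≤ 1 + ε₀ := by linarith
  have hmono : ∀ a : ℝ, min a₀ a₁ ≤ a →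
      (1 + ε₀) ^ (-a) * M ≤ (1 + ε₀) ^ (-min a₀ a₁) * M := fun a ha =>
    mul_le_mul_of_nonneg_right (Real.rpow_le_rpow_of_exponent_le h1 (by linarith)) hM0
  rcases hW.nonneg.eq_or_lt with h0 | hpos
  · -- `ν̂ = 0`: an inviscid eternal solution, child (A)
    rw [← h0] at hW
    have hW0 : IsEternal ε₀ α W := isEternalVisc_zero_iff.1 hW
    exact (HA ε₀ hε₀ (hle.trans (min_le_left _ _)) α hα W hW0 hU n M hM σ).trans
      (hmono a₀ (min_le_left _ _))
  · -- `ν̂ > 0`: child (B)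
    exact (HB ε₀ hε₀ (hle.trans (min_le_right _ _)) α hα νh W hpos hW hU n M hM σ).trans
      (hmono a₁ (min_le_right _ _))

end Summit.NavierStokesRegularity.NavierStokesRegularity.Theorems

end
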